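import Summits.NavierStokesRegularity.NavierStokesRegularity.Theorems.QuantisedSymmetryPolyhedralTruncationBridge
import Literature.Analysis.FluidPDE.SelfSimilarLiouville
import HarnessLib

/-!
# Strategist sketch s16 — crux `PolyhedralDssProfileExists` (stmt-NavierStokesRegularity-1404)

Typed companion of `STRATEGY-CENSUS-s16.md` (census family `s`, independent, 2026-08-28).
No `sorry`. What is certified here:

* `crux_decides_summit` — the crux ALONE refutes Clay (A): the other two binders of the route's
  deciding theorem `QuantisedSymmetry.closes` are theorems of the tree
  (`quantisedSymmetry_polyhedralTruncationBridge_proof`, `ClayUniqueness_holds`). So any proof of the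
  crux is a proof of `¬ NavierStokesRegularity` (Clay (C) via the landed dichotomy): the crux is
  summit-deciding, and strictly stronger than the decided statement as far as anyone knows (a
  blow-up need not be Type I, discretely self-similar or polyhedral).
* `DssProfileExistsNoSymmetry` — the STRICTLY-WEAKER intermediate obtained by deleting the four
  group clauses (= `∃ c, ¬ TypeIDSSLiouville c`, `noSymmetry_iff_exists_not_typeIDSSLiouville`); it is
  implied by the crux (`noSymmetry_of_crux`) and STILL decides the summit
  (`noSymmetry_decides_summit`, through the landed rotation-free instance of
  `filamentSkeletonRss_rdssProfileTruncation_proof`). It is the deciding crux of the sibling routes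
  (Tsai's Type-I DSS Liouville conjecture negated) — replacing the crux by it merges routes and
  imports no mechanism.
* `RdssWitness` — one step weaker again (rotated DSS, any `R ∈ O(3)`): antecedent of
  `FilamentSkeletonRss.RdssProfileTruncation`; also decides (`rdssWitness_decides_summit`).
* The bridge split `¬ PolyhedralTypeILiouville ∧ (¬ PolyhedralTypeILiouville → crux)`: typed
  (`PieceNotLiouville`, `PieceDssisation`, `crux_of_pieces`); the census explains why the second
  piece is the whole crux (a periodic point of the scaling flow, not a recurrent one, is needed).
-/

set_option linter.dupNamespace false

namespace Summit.NavierStokesRegularity.NavierStokesRegularity.Cruxes.PolyhedralDssProfileExists.S16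

open MeasureTheory Set
open Literature.Analysis.FluidPDE
open Summit.NavierStokesRegularity.NavierStokesRegularity.Theses

/-! ## 1. The crux alone decides the summit -/

/-- The crux refutes Clay (A) outright: `closes` with its two other binders discharged by landed
theorems. [folklore] -/
theorem crux_decides_summit :
    QuantisedSymmetry.PolyhedralDssProfileExists → ¬ _root_.NavierStokesRegularity :=
  fun h => QuantisedSymmetry.closes h
    Summit.NavierStokesRegularity.NavierStokesRegularity.Theorems.quantisedSymmetry_polyhedralTruncationBridge_proof
    QuantisedSymmetry.ClayUniqueness_holds

/-! ## 2. The strictly-weaker intermediates that still decide -/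

/-- W₁: a nontrivial Type-I `λ`-DSS ancient mild profile, NO symmetry clause (the crux minus its
four group-theoretic conjuncts). [folklore] -/
def DssProfileExistsNoSymmetry : Prop :=
  ∃ c : ℝ, 1 < c ∧ ∃ u : ℝ → EuclideanSpace ℝ (Fin 3) → EuclideanSpace ℝ (Fin 3),
    IsAncientMildSolution 1 u ∧ (∀ t < 0, AEStronglyMeasurable (u t) volume) ∧
    IsDiscretelySelfSimilar c u ∧ (∃ C₀ : ℝ, HasTypeIDecay C₀ u) ∧ ¬ (∀ t < 0, u t =ᵐ[volume] 0)

/-- W₂: the rotated version (any `R ∈ O(3)`): the antecedent of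
`FilamentSkeletonRss.RdssProfileTruncation` (stmt-NavierStokesRegularity-11289). [folklore] -/
def RdssWitness : Prop :=
  ∃ (c : ℝ) (R : EuclideanSpace ℝ (Fin 3) ≃ₗᵢ[ℝ] EuclideanSpace ℝ (Fin 3))
    (u : ℝ → EuclideanSpace ℝ (Fin 3) → EuclideanSpace ℝ (Fin 3)),
    1 < c ∧ IsAncientMildSolution 1 u ∧ (∀ t < 0, AEStronglyMeasurable (u t) volume) ∧
    IsRotatedDSS c R u ∧ (∃ C₀ : ℝ, HasTypeIDecay C₀ u) ∧ ¬ (∀ t < 0, u t =ᵐ[volume] 0)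

/-- crux ⇒ W₁ (forget `G`). [folklore] -/
theorem noSymmetry_of_crux (h : QuantisedSymmetry.PolyhedralDssProfileExists) :
    DssProfileExistsNoSymmetry := by
  obtain ⟨_G, _hfin, _hdet, _hirr, c, hc, u, hanc, hmeas, hdss, hdec, _heqv, hnt⟩ := h
  exact ⟨c, hc, u, hanc, hmeas, hdss, hdec, hnt⟩

/-- W₁ ⇒ W₂ (plain DSS is rotated DSS with the trivial rotation, `isRotatedDSS_refl_iff`). [folklore] -/
theorem rdssWitness_of_noSymmetry (h : DssProfileExistsNoSymmetry) : RdssWitness := by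
  obtain ⟨c, hc, u, hanc, hmeas, hdss, hdec, hnt⟩ := h
  exact ⟨c, LinearIsometryEquiv.refl ℝ (EuclideanSpace ℝ (Fin 3)), u, hc, hanc, hmeas,
    isRotatedDSS_refl_iff.mpr hdss, hdec, hnt⟩

/-- W₁ is literally "Tsai's plain Type-I DSS Liouville statement fails for some factor". [folklore] -/
theorem noSymmetry_iff_exists_not_typeIDSSLiouville :
    DssProfileExistsNoSymmetry ↔ ∃ c : ℝ, ¬ TypeIDSSLiouville c := by
  constructor
  · rintro ⟨c, hc, u, hanc, hmeas, hdss, hdec, hnt⟩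
    exact ⟨c, fun hL => hnt (hL hc u hanc hmeas hdss hdec)⟩
  · rintro ⟨c, hL⟩
    by_contra hne
    apply hL
    intro hc u hanc hmeas hdss hdec
    by_contra hnt
    exact hne ⟨c, hc, u, hanc, hmeas, hdss, hdec, hnt⟩

/-- W₂ decides the summit: the landed rotated truncation bridge + Clay uniqueness (the body is the
route's `closes` with `hB` replaced by the FilamentSkeletonRss theorem). [folklore] -/
theorem rdssWitness_decides_summit (hW : RdssWitness) : ¬ _root_.NavierStokesRegularity := by
  rintro hA
  obtain ⟨ν, hν, T, hT, u, p, ⟨hcl, hmax⟩, hLH, hdecay⟩ :=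
    Summit.NavierStokesRegularity.NavierStokesRegularity.Theorems.filamentSkeletonRss_rdssProfileTruncation_proof
      hW
  have h0 : (0 : ℝ) ∈ Set.Ico 0 T := ⟨le_rfl, hT⟩
  obtain ⟨u', p', hu', hp', hns, hbe⟩ :=
    hA ν hν (u 0) (hcl.contDiff_velocity h0) (hcl.divFree 0 h0) hdecay
  have heq : ∀ t ∈ Set.Ico 0 T, u' t = u t :=
    QuantisedSymmetry.ClayUniqueness_holds ν hν (u 0) hdecay u' u p' p T hT hu' hp' hns hbe hcl hLH
      rfl
  have hcl' : IsClassicalNSSolutionOn (Set.Ici 0) ν 0 u' p' :=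
    ⟨hu', hp', fun t ht x => hns.momentum t ht x, fun t ht => hns.divFree t ht⟩
  refine hmax ⟨T + 1, by linarith, u', p', ?_, heq⟩
  exact hcl'.mono (fun t ht => ht.1) (uniqueDiffOn_Ico 0 (T + 1))

/-- W₁ decides the summit. [folklore] -/
theorem noSymmetry_decides_summit (hW : DssProfileExistsNoSymmetry) :
    ¬ _root_.NavierStokesRegularity :=
  rdssWitness_decides_summit (rdssWitness_of_noSymmetry hW)

/-- The chain crux ⇒ W₁ ⇒ W₂ ⇒ ¬(A), assembled. [folklore] -/
theorem crux_decides_summit' (h : QuantisedSymmetry.PolyhedralDssProfileExists) :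
    ¬ _root_.NavierStokesRegularity :=
  noSymmetry_decides_summit (noSymmetry_of_crux h)

/-! ## 3. The bridge split through the kill switch (recorded, not recommended) -/

/-- Piece T: the polyhedral Type-I Liouville statement (route item stmt-1405) FAILS — a nontrivial
`G`-equivariant Type-I bounded ancient mild solution exists (not necessarily DSS). A CONSEQUENCE of
the crux (`LiouvilleKillsProfile`, proved in tree). [folklore] -/
def PieceNotLiouville : Prop := ¬ QuantisedSymmetry.PolyhedralTypeILiouville

/-- Piece D ("DSS-isation"): from some polyhedral Type-I ancient solution to a PERIODIC point of the
scaling flow. The whole difficulty of the crux sits here (census §Decomposition). [folklore] -/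
def PieceDssisation : Prop := PieceNotLiouville → QuantisedSymmetry.PolyhedralDssProfileExists

/-- The (modus-ponens) assembly of the bridge split. [folklore] -/
theorem crux_of_pieces (hT : PieceNotLiouville) (hD : PieceDssisation) :
    QuantisedSymmetry.PolyhedralDssProfileExists :=
  hD hT

end Summit.NavierStokesRegularity.NavierStokesRegularity.Cruxes.PolyhedralDssProfileExists.S16
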